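import Mathlib
import Summits.NavierStokesRegularity.NavierStokesRegularity.Theorems.FilamentSkeletonRssStadiumContourPositivityAbs
import Summits.NavierStokesRegularity.NavierStokesRegularity.Theorems.FilamentSkeletonRssStadiumChordCrude

/-!
# Uniform principal-branch MARGIN near a plateau height (`TangentSkeletonNearStraightL`, stmt-NavierStokesRegularity-23320, registered stub
# `stub_stripPropagation` — item R1 of the blueprint `DIAG-addendum-contour-g2.md`)

For the frozen-contour pieces (Theorems.StadiumFixedSourcePiece) and the thin rectangles of the contour-independence step one needs a lower bound on
`Re(Q + κG)` that is UNIFORM for targets `z` near a height `y₀` and sources `ζ` at (or between) nearby heights: `|Im z − Im ζ| ≤ δ`.  Case split on the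
horizontal offset: `|Re(z−ζ)| ≥ r₀` ⇒ slope `≤ δ/r₀ ≤ m` and Theorems.StadiumContourPositivityAbs.pair_base_re_ge_slope_abs gives
`Re ≥ r₀²·((1−m²)A₁ − 2m·A₂)`; `|Re(z−ζ)| < r₀` ⇒ `‖z − ζ‖ < r₀ + δ` and Theorems.StadiumChordCrude.re_base_ge_core_sub gives `Re ≥ κΛ⁻¹/2 − 3M²(r₀+δ)²
≥ κΛ⁻¹/4` once `3M²(r₀+δ)² ≤ κΛ⁻¹/4` (`base_re_margin`).  The stadium is convex, so the segment `[ζ, z]` stays inside it (`stadium_convex`).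
HONEST FRAMING: a tool for a HYPOTHETICAL filament skeleton on the NEGATIVE side of a MODEL route; nothing here bears on Navier–Stokes regularity or
blow-up.  `--supports stmt-NavierStokesRegularity-23320`.
-/

set_option linter.dupNamespace false

noncomputable section

namespace Summit.NavierStokesRegularity.NavierStokesRegularity.Theorems.StadiumBaseMargin

open Set Metric
open scoped InnerProductSpace
open Summit.NavierStokesRegularity.NavierStokesRegularity.Theorems.StadiumContourPositivityAbs
open Summit.NavierStokesRegularity.NavierStokesRegularity.Theorems.StadiumChordCrude

/-- The rectangle stadium is convex. [folklore] -/
theorem stadium_convex (hs L cc : ℝ) : Convex ℝ {z : ℂ | |z.im| < hs ∧ |z.re - cc| < L + hs} := by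
  have h1 : Convex ℝ {z : ℂ | |z.im| < hs} := by
    have : {z : ℂ | |z.im| < hs} = Complex.imLm ⁻¹' Set.Ioo (-hs) hs := by
      ext z; simp [abs_lt]
    rw [this]; exact (convex_Ioo _ _).linear_preimage _
  have h2 : Convex ℝ {z : ℂ | |z.re - cc| < L + hs} := by
    have : {z : ℂ | |z.re - cc| < L + hs} = Complex.reLm ⁻¹' Set.Ioo (cc - (L + hs)) (cc + (L + hs)) := by
      ext z; simp only [mem_setOf_eq, mem_preimage, Complex.reLm_coe, mem_Ioo, abs_lt]; constructor <;> intro h <;> constructor <;> linarith [h.1, h.2]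
    rw [this]; exact (convex_Ioo _ _).linear_preimage _
  have : {z : ℂ | |z.im| < hs ∧ |z.re - cc| < L + hs} = {z : ℂ | |z.im| < hs} ∩ {z : ℂ | |z.re - cc| < L + hs} := by ext z; simp
  rw [this]; exact h1.inter h2

/-- **Uniform margin near a plateau height.**  See the module docstring. [folklore] -/
theorem base_re_margin {hs L cc M Rb n m r₀ δ κ Λ : ℝ} {F : ℂ → (Fin 3 → ℂ)}
    (hF : DifferentiableOn ℂ F {z : ℂ | |z.im| < hs ∧ |z.re - cc| < L + hs})
    (hunit : ∀ w ∈ {z : ℂ | |z.im| < hs ∧ |z.re - cc| < L + hs}, ∑ i, (deriv F w i) ^ 2 = 1)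
    (hM : ∀ z ∈ {z : ℂ | |z.im| < hs ∧ |z.re - cc| < L + hs}, ‖deriv F z‖ ≤ M)
    {X : ℝ → EuclideanSpace ℝ (Fin 3)} (hX : Differentiable ℝ X) (hXu : ∀ τ, ‖deriv X τ‖ = 1)
    (hosc : ∀ τ σ, ‖deriv X τ - deriv X σ‖ ≤ Rb)
    (hFX : ∀ r : ℝ, (r : ℂ) ∈ {z : ℂ | |z.im| < hs ∧ |z.re - cc| < L + hs} →
      F r = fun i => ((⟪X r, EuclideanSpace.single i (1:ℝ)⟫_ℝ : ℝ) : ℂ))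
    (hn : 1 < n) {z ζ : ℂ}
    (hzS : z ∈ {z : ℂ | |z.im| < hs ∧ |z.re - cc| < L + hs}) (hζS : ζ ∈ {z : ℂ | |z.im| < hs ∧ |z.re - cc| < L + hs})
    (hzfit : n * |z.im| < hs) (hzfit' : |z.re - cc| + n * |z.im| < L + hs)
    (hζfit : n * |ζ.im| < hs) (hζfit' : |ζ.re - cc| + n * |ζ.im| < L + hs)
    (hκ : 0 < κ) (hΛ : 0 < Λ) {Gv : ℂ} (hG : Λ⁻¹ / 2 ≤ Gv.re)
    (hm0 : 0 ≤ m) (hm1 : m ≤ 1) (hr₀ : 0 < r₀) (hδ : |z.im - ζ.im| ≤ δ) (hδm : δ ≤ m * r₀)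
    (hsmall : 3 * M ^ 2 * (r₀ + δ) ^ 2 ≤ κ * Λ⁻¹ / 4)
    (hA : 0 ≤ 1 - (Rb + 2 * (√3 * (2 * M * (Real.log (n / (n - 1)) - 1 / n)))) ^ 2 / 2)
    (hC : 0 ≤ (1 - m ^ 2) * (1 - (Rb + 2 * (√3 * (2 * M * (Real.log (n / (n - 1)) - 1 / n)))) ^ 2 / 2) -
      2 * m * (2 * (√3 * (M * Real.log (n / (n - 1)))) * (Rb + 2 * (√3 * (2 * M * (Real.log (n / (n - 1)) - 1 / n)))))) :
    min (κ * Λ⁻¹ / 4)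
      (r₀ ^ 2 * ((1 - m ^ 2) * (1 - (Rb + 2 * (√3 * (2 * M * (Real.log (n / (n - 1)) - 1 / n)))) ^ 2 / 2) -
        2 * m * (2 * (√3 * (M * Real.log (n / (n - 1)))) * (Rb + 2 * (√3 * (2 * M * (Real.log (n / (n - 1)) - 1 / n))))))) ≤
      ((∑ i, (F z i - F ζ i) ^ 2) + (κ : ℂ) * Gv).re := by
  set C : ℝ := (1 - m ^ 2) * (1 - (Rb + 2 * (√3 * (2 * M * (Real.log (n / (n - 1)) - 1 / n)))) ^ 2 / 2) -
      2 * m * (2 * (√3 * (M * Real.log (n / (n - 1)))) * (Rb + 2 * (√3 * (2 * M * (Real.log (n / (n - 1)) - 1 / n))))) with hCdef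
  by_cases hfar : r₀ ≤ |z.re - ζ.re|
  · -- sloped pair
    have hslope : |z.im - ζ.im| ≤ m * |z.re - ζ.re| := hδ.trans (hδm.trans (mul_le_mul_of_nonneg_left hfar hm0))
    have h := pair_base_re_ge_slope_abs hF hunit hM hX hXu hosc hFX hn hzfit hzfit' hζfit hζfit' hm0 hm1 hslope hA hκ.le hG
    rw [← hCdef] at h
    have h1 : r₀ ^ 2 * C ≤ (z.re - ζ.re) ^ 2 * C := by
      have : r₀ ^ 2 ≤ (z.re - ζ.re) ^ 2 := by
        have := pow_le_pow_left₀ hr₀.le hfar 2; rwa [sq_abs] at this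
      exact mul_le_mul_of_nonneg_right this hC
    have h2 : 0 ≤ κ * (Λ⁻¹ / 2) := by positivity
    exact (min_le_right _ _).trans (by linarith)
  · -- close pair: crude bound
    have hfar : |z.re - ζ.re| < r₀ := lt_of_not_ge hfar
    have hseg : segment ℝ ζ z ⊆ {z : ℂ | |z.im| < hs ∧ |z.re - cc| < L + hs} :=
      (stadium_convex hs L cc).segment_subset hζS hzS
    have hSo : IsOpen {z : ℂ | |z.im| < hs ∧ |z.re - cc| < L + hs} := by
      have h1 : IsOpen {z : ℂ | |z.im| < hs} := isOpen_lt (continuous_abs.comp Complex.continuous_im) continuous_const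
      have h2 : IsOpen {z : ℂ | |z.re - cc| < L + hs} :=
        isOpen_lt (continuous_abs.comp (Complex.continuous_re.sub continuous_const)) continuous_const
      exact h1.inter h2
    have hdiff : ∀ w ∈ segment ℝ ζ z, DifferentiableAt ℂ F w := fun w hw => hF.differentiableAt (hSo.mem_nhds (hseg hw))
    have hMseg : ∀ w ∈ segment ℝ ζ z, ‖deriv F w‖ ≤ M := fun w hw => hM w (hseg hw)
    have h := re_base_ge_core_sub hdiff hMseg hκ.le hG
    have hnorm : ‖z - ζ‖ ≤ r₀ + δ := by
      have h1 := Complex.norm_le_abs_re_add_abs_im (z - ζ)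
      rw [Complex.sub_re, Complex.sub_im] at h1
      linarith
    have hsq : ‖z - ζ‖ ^ 2 ≤ (r₀ + δ) ^ 2 := pow_le_pow_left₀ (norm_nonneg _) hnorm 2
    have hM2 : 0 ≤ 3 * M ^ 2 := by positivity
    have h3 : 3 * M ^ 2 * ‖z - ζ‖ ^ 2 ≤ κ * Λ⁻¹ / 4 := (mul_le_mul_of_nonneg_left hsq hM2).trans hsmall
    exact (min_le_left _ _).trans (by linarith)

end Summit.NavierStokesRegularity.NavierStokesRegularity.Theorems.StadiumBaseMargin

end
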